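import Summits.Ventures.PercRepro.SixFourResidueFourPlaneLineTWDefs

/-!
# PercRepro — C-025 at `(6,4)`: the TW-100 table at `t = 4`, `53 ≤ g ≤ 68` (p3, gen 11 — §21.18.7)

The per-`g` checks `minCheckAll g` (the minimiser `m*(g,q)` of `L(g,q,m)/C(m,2)` is a minimiser, integer form) and
`twCheckAll g` (the cell inequality `w′(g,n,e,s) ≥ 0` of Lemma TW with `μ = L(m*)/C(m*,2)`, integer form) for `53 ≤ g ≤ 68`,
by `decide +kernel`; see `SixFourResidueFourPlaneLineTWDefs.lean` for the definitions and the transfer lemmas.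
-/

namespace PercRepro.SixFour

set_option maxRecDepth 20000

/-- `minCheckAll 53` (by `decide +kernel`). -/
theorem minCheckAll_53 : minCheckAll 53 := by unfold minCheckAll; decide +kernel
/-- `twCheckAll 53` (by `decide +kernel`). -/
theorem twCheckAll_53 : twCheckAll 53 := by unfold twCheckAll; decide +kernel

/-- `minCheckAll 54` (by `decide +kernel`). -/
theorem minCheckAll_54 : minCheckAll 54 := by unfold minCheckAll; decide +kernel
/-- `twCheckAll 54` (by `decide +kernel`). -/
theorem twCheckAll_54 : twCheckAll 54 := by unfold twCheckAll; decide +kernel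

/-- `minCheckAll 55` (by `decide +kernel`). -/
theorem minCheckAll_55 : minCheckAll 55 := by unfold minCheckAll; decide +kernel
/-- `twCheckAll 55` (by `decide +kernel`). -/
theorem twCheckAll_55 : twCheckAll 55 := by unfold twCheckAll; decide +kernel

/-- `minCheckAll 56` (by `decide +kernel`). -/
theorem minCheckAll_56 : minCheckAll 56 := by unfold minCheckAll; decide +kernel
/-- `twCheckAll 56` (by `decide +kernel`). -/
theorem twCheckAll_56 : twCheckAll 56 := by unfold twCheckAll; decide +kernel

/-- `minCheckAll 57` (by `decide +kernel`). -/
theorem minCheckAll_57 : minCheckAll 57 := by unfold minCheckAll; decide +kernel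
/-- `twCheckAll 57` (by `decide +kernel`). -/
theorem twCheckAll_57 : twCheckAll 57 := by unfold twCheckAll; decide +kernel

/-- `minCheckAll 58` (by `decide +kernel`). -/
theorem minCheckAll_58 : minCheckAll 58 := by unfold minCheckAll; decide +kernel
/-- `twCheckAll 58` (by `decide +kernel`). -/
theorem twCheckAll_58 : twCheckAll 58 := by unfold twCheckAll; decide +kernel

/-- `minCheckAll 59` (by `decide +kernel`). -/
theorem minCheckAll_59 : minCheckAll 59 := by unfold minCheckAll; decide +kernel
/-- `twCheckAll 59` (by `decide +kernel`). -/
theorem twCheckAll_59 : twCheckAll 59 := by unfold twCheckAll; decide +kernel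

/-- `minCheckAll 60` (by `decide +kernel`). -/
theorem minCheckAll_60 : minCheckAll 60 := by unfold minCheckAll; decide +kernel
/-- `twCheckAll 60` (by `decide +kernel`). -/
theorem twCheckAll_60 : twCheckAll 60 := by unfold twCheckAll; decide +kernel

/-- `minCheckAll 61` (by `decide +kernel`). -/
theorem minCheckAll_61 : minCheckAll 61 := by unfold minCheckAll; decide +kernel
/-- `twCheckAll 61` (by `decide +kernel`). -/
theorem twCheckAll_61 : twCheckAll 61 := by unfold twCheckAll; decide +kernel

/-- `minCheckAll 62` (by `decide +kernel`). -/
theorem minCheckAll_62 : minCheckAll 62 := by unfold minCheckAll; decide +kernel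
/-- `twCheckAll 62` (by `decide +kernel`). -/
theorem twCheckAll_62 : twCheckAll 62 := by unfold twCheckAll; decide +kernel

/-- `minCheckAll 63` (by `decide +kernel`). -/
theorem minCheckAll_63 : minCheckAll 63 := by unfold minCheckAll; decide +kernel
/-- `twCheckAll 63` (by `decide +kernel`). -/
theorem twCheckAll_63 : twCheckAll 63 := by unfold twCheckAll; decide +kernel

/-- `minCheckAll 64` (by `decide +kernel`). -/
theorem minCheckAll_64 : minCheckAll 64 := by unfold minCheckAll; decide +kernel
/-- `twCheckAll 64` (by `decide +kernel`). -/
theorem twCheckAll_64 : twCheckAll 64 := by unfold twCheckAll; decide +kernel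

/-- `minCheckAll 65` (by `decide +kernel`). -/
theorem minCheckAll_65 : minCheckAll 65 := by unfold minCheckAll; decide +kernel
/-- `twCheckAll 65` (by `decide +kernel`). -/
theorem twCheckAll_65 : twCheckAll 65 := by unfold twCheckAll; decide +kernel

/-- `minCheckAll 66` (by `decide +kernel`). -/
theorem minCheckAll_66 : minCheckAll 66 := by unfold minCheckAll; decide +kernel
/-- `twCheckAll 66` (by `decide +kernel`). -/
theorem twCheckAll_66 : twCheckAll 66 := by unfold twCheckAll; decide +kernel

/-- `minCheckAll 67` (by `decide +kernel`). -/
theorem minCheckAll_67 : minCheckAll 67 := by unfold minCheckAll; decide +kernel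
/-- `twCheckAll 67` (by `decide +kernel`). -/
theorem twCheckAll_67 : twCheckAll 67 := by unfold twCheckAll; decide +kernel

/-- `minCheckAll 68` (by `decide +kernel`). -/
theorem minCheckAll_68 : minCheckAll 68 := by unfold minCheckAll; decide +kernel
/-- `twCheckAll 68` (by `decide +kernel`). -/
theorem twCheckAll_68 : twCheckAll 68 := by unfold twCheckAll; decide +kernel

/-- `minCheckAll g` for every `53 ≤ g ≤ 68`. -/
theorem minCheckAll_of_rangeC {g : ℕ} (hg : 53 ≤ g) (hg' : g ≤ 68) : minCheckAll g := by
  interval_cases g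
  exacts [minCheckAll_53, minCheckAll_54, minCheckAll_55, minCheckAll_56, minCheckAll_57, minCheckAll_58, minCheckAll_59, minCheckAll_60, minCheckAll_61, minCheckAll_62, minCheckAll_63, minCheckAll_64, minCheckAll_65, minCheckAll_66, minCheckAll_67, minCheckAll_68]

/-- `twCheckAll g` for every `53 ≤ g ≤ 68`. -/
theorem twCheckAll_of_rangeC {g : ℕ} (hg : 53 ≤ g) (hg' : g ≤ 68) : twCheckAll g := by
  interval_cases g
  exacts [twCheckAll_53, twCheckAll_54, twCheckAll_55, twCheckAll_56, twCheckAll_57, twCheckAll_58, twCheckAll_59, twCheckAll_60, twCheckAll_61, twCheckAll_62, twCheckAll_63, twCheckAll_64, twCheckAll_65, twCheckAll_66, twCheckAll_67, twCheckAll_68]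

end PercRepro.SixFour
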